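import Summits.SmoothPoincare4.SmoothPoincare4.Theses.WeylBudget
import Summits.SmoothPoincare4.SmoothPoincare4.Theorems.WeylBudgetCorkRegluingBudgetIsometricRegluingTransport
import Summits.SmoothPoincare4.SmoothPoincare4.Theorems.WeylBudgetCorkRegluingBudgetIsometricRegluingGlue
import Literature.Topology.FourManifolds.GluedMetric
import Literature.Topology.FourManifolds.GluingProofs
import Literature.Geometry.Lorentzian.IsometryProofs
import Literature.Geometry.Manifold.InjOnLocalDiffeomorphInverse
import Literature.Geometry.Manifold.SmoothEmbeddingCodRestrict
import HarnessLib

/-!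
# Stub B2 `stub_isometricRegluing` of the crux `CorkRegluingBudget`: isometric regluing realises the cork twist

Crux `Summit.SmoothPoincare4.SmoothPoincare4.Theses.WeylBudget.CorkRegluingBudget` (item
stmt-SmoothPoincare4-10831, route WeylBudget, line `registered` = `Lines/birth.lean`), Stub B2.
Everything here is proved; no definitions, no named facts.

Let `S⁴ = C ∪_φ W` be presented by piece embeddings `jC, jW` (seam relation
`jC (ι z) = jW (ι (φ z))`), `g` a Riemannian metric on `S⁴`, and `Φ` a map which on an open
neighbourhood `U` of the seam is smooth, injective, a `g`-isometry, side-preserving, and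
restricts to `τ` on the seam.  Then EVERY smooth 4-manifold `P` that is a boundary gluing
`C ∪_{φ ∘ τ} W` is covered by smooth embeddings `kC, kW` meeting exactly along
`kC (ι z) = kW (ι (φ (τ z)))` and carries a Riemannian metric `γ` with the same piece metrics,
`jC^* g = kC^* γ`, `jW^* g = kW^* γ` (`stub_isometricRegluing`, signature verbatim from the
registered skeleton).

Proof (Hirsch 1976, Ch. 8 §2 / Bröcker–Jänich 1982, §13 for the gluing; O'Neill 1983, Ch. 3
for the metric), over the tree's open-gluing construction `SmoothGlueData`:

* `isometricOpenRegluing` — if the seam is nonempty: `dΦ` is invertible on `U` (isometry of a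
  Riemannian metric, `bijective_mfderiv_of_pullbackBilin_eq`); shrink `U` to an open `N ⊇ seam`
  with `N̄ ⊆ U`; glue the open submanifolds `M₁ = (S ∖ jW W) ∪ N ⊇ jC C` and
  `M₂ = (S ∖ jC C) ∪ Φ(N) ⊇ jW W` along `Φ| : N → Φ(N)` (`helper_exists_smoothGlueData`); the
  piece embeddings `[jC] : C → M₁ → X`, `[jW] : W → M₂ → X` cover `X`, and — because `Φ` is
  side-preserving, injective on `U` and restricts to `τ` on the seam — meet exactly along the
  TWISTED relation `[jC (ι z)] = [jW (ι (φ (τ z)))]`; the metrics `g|M₁`, `g|M₂` patch to a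
  Riemannian `γ` on `X` since `Φ|` is an isometry (`SmoothGlueData.exists_metric_of_glue_isometry`),
  and `kC^* γ = jC^* g`, `kW^* γ = jW^* g` by naturality of the pullback.
* `stub_isometricRegluing` — transport `(X, kC, kW, γ)` to the given `P` along the uniqueness of
  boundary gluings (`helper_isometricTransport`, Hirsch Ch. 8 §2 Thm. 2.1); if the seam is empty,
  `S⁴` itself with `jC, jW, g` is already the twisted gluing and is transported directly.

References: M. W. Hirsch, *Differential Topology*, GTM 33 (1976), Ch. 8 §2, Thm. 2.1
[HirschDT1976]; T. Bröcker, K. Jänich, *Introduction to Differential Topology* (1982), §13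
[BrockerJanich1982]; B. O'Neill, *Semi-Riemannian Geometry* (1983), Ch. 3, pp. 58, 90–91
[ONeill1983].
-/

-- the prescribed namespace `Summit.<P>.<Sub>.…` duplicates `SmoothPoincare4` (P = Sub)
set_option linter.dupNamespace false

open scoped Manifold ContDiff Topology
open Set Function

noncomputable section

namespace Summit.SmoothPoincare4.SmoothPoincare4.Theorems.CorkRegluingBudget

open Literature.Geometry.Lorentzian Literature.Geometry.Lorentzian.PseudoRiemannianMetric
  Literature.Geometry.Manifold Literature.Topology.FourManifolds

/-! ### The open regluing of a local isometry (steps (b), (c), (f), (g)) -/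

/-- **Isometric open regluing along a germ isometry** (the core of Stub B2 `stub_isometricRegluing`
of the crux `CorkRegluingBudget`; Hirsch 1976, Ch. 8 §2 / Bröcker–Jänich 1982, §13 for the gluing,
O'Neill 1983, Ch. 3, pp. 90–91 for the metric).  Let the compact Hausdorff smooth 4-manifold `S`
be presented as `C ∪_φ W` by piece embeddings `jC, jW` (seam relation `jC (ι z) = jW (ι (φ z))`),
let `g` be a Riemannian metric on `S`, and let `Φ` be smooth and injective on an open
neighbourhood `U` of the (nonempty) seam, a `g`-isometry there, side-preserving, and restricting
to `τ` on the seam.  Then there is a smooth 4-manifold `X` — the open gluing of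
`M₁ = (S ∖ jW W) ∪ N` and `M₂ = (S ∖ jC C) ∪ Φ(N)` along `Φ| : N → Φ(N)` for a neighbourhood `N`
of the seam with `N̄ ⊆ U` — with piece embeddings `kC = [jC]`, `kW = [jW]` presenting `X` as the
TWISTED gluing `C ∪_{φ ∘ τ} W` (seam relation for `τ.trans φ`) and a Riemannian metric `γ`
(`g|M₁ ⊔ g|M₂`, which patch because `Φ` is an isometry, `SmoothGlueData.exists_metric_of_glue_isometry`)
inducing the same piece metrics: `jC^* g = kC^* γ`, `jW^* g = kW^* γ`.  No separation property
of `X` is asserted (it is Hausdorff, being a gluing of compact Hausdorff pieces, but this is not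
needed downstream). [cite: HirschDT1976, Ch. 8 §2] [cite: ONeill1983, Ch. 3, pp. 90–91] -/
theorem isometricOpenRegluing
    (C : Type) [TopologicalSpace C] [ChartedSpace (EuclideanHalfSpace 4) C]
    [IsManifold (𝓡∂ 4) ∞ C] [CompactSpace C]
    (bC : BoundaryData (𝓡∂ 4) C (𝓡 3))
    (W : Type) [TopologicalSpace W] [ChartedSpace (EuclideanHalfSpace 4) W]
    [IsManifold (𝓡∂ 4) ∞ W] [CompactSpace W]
    (bW : BoundaryData (𝓡∂ 4) W (𝓡 3))
    (φ : bC.carrier ≃ₘ⟮𝓡 3, 𝓡 3⟯ bW.carrier) (τ : bC.carrier ≃ₘ⟮𝓡 3, 𝓡 3⟯ bC.carrier)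
    (S : Type) [TopologicalSpace S] [T2Space S] [CompactSpace S]
    [ChartedSpace (EuclideanSpace ℝ (Fin 4)) S] [IsManifold (𝓡 4) ∞ S]
    (jC : C → S) (jW : W → S)
    (g : PseudoRiemannianMetric (𝓡 4) ∞ (EuclideanSpace ℝ (Fin 4)) (TangentSpace (𝓡 4) : S → Type _))
    (U : Set S) (Φ : S → S)
    (hjC : Manifold.IsSmoothEmbedding (𝓡∂ 4) (𝓡 4) ∞ jC)
    (hjW : Manifold.IsSmoothEmbedding (𝓡∂ 4) (𝓡 4) ∞ jW)
    (hcov : range jC ∪ range jW = univ)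
    (hseam : ∀ a b, jC a = jW b ↔ ∃ z, a = bC.incl z ∧ b = bW.incl (φ z))
    (hg : g.IsRiemannian) (hU : IsOpen U) (hYU : ∀ z, jC (bC.incl z) ∈ U)
    (hΦs : ContMDiffOn (𝓡 4) (𝓡 4) ∞ Φ U) (hΦi : InjOn Φ U)
    (hΦg : ∀ x ∈ U, pullbackBilin (I := 𝓡 4) (I' := 𝓡 4) Φ g.val x = g.val x)
    (hΦC : ∀ x ∈ U, x ∈ range jC → Φ x ∈ range jC)
    (hΦW : ∀ x ∈ U, x ∈ range jW → Φ x ∈ range jW)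
    (hΦτ : ∀ z, Φ (jC (bC.incl z)) = jC (bC.incl (τ z))) [Nonempty bC.carrier] :
    ∃ (X : Type) (_ : TopologicalSpace X) (_ : ChartedSpace (EuclideanSpace ℝ (Fin 4)) X)
      (_ : IsManifold (𝓡 4) ∞ X) (kC : C → X) (kW : W → X)
      (γ : PseudoRiemannianMetric (𝓡 4) ∞ (EuclideanSpace ℝ (Fin 4))
        (TangentSpace (𝓡 4) : X → Type _)),
      Manifold.IsSmoothEmbedding (𝓡∂ 4) (𝓡 4) ∞ kC ∧
        Manifold.IsSmoothEmbedding (𝓡∂ 4) (𝓡 4) ∞ kW ∧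
        range kC ∪ range kW = univ ∧
        (∀ a b, kC a = kW b ↔ ∃ z, a = bC.incl z ∧ b = bW.incl ((τ.trans φ) z)) ∧
        γ.IsRiemannian ∧
        (∀ c, pullbackBilin (I := 𝓡 4) (I' := 𝓡∂ 4) jC g.val c =
          pullbackBilin (I := 𝓡 4) (I' := 𝓡∂ 4) kC γ.val c) ∧
        (∀ w, pullbackBilin (I := 𝓡 4) (I' := 𝓡∂ 4) jW g.val w =
          pullbackBilin (I := 𝓡 4) (I' := 𝓡∂ 4) kW γ.val w) := by
  classical
  -- the two (closed) pieces of `S`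
  set RC : Set S := range jC with hRC
  set RW : Set S := range jW with hRW
  have hRCc : IsClosed RC := (isCompact_range hjC.contMDiff.continuous).isClosed
  have hRWc : IsClosed RW := (isCompact_range hjW.contMDiff.continuous).isClosed
  have hcovx : ∀ x : S, x ∈ RC ∨ x ∈ RW := fun x ↦ by
    have hx := mem_univ x
    rw [← hcov] at hx
    exact hx
  -- (b) the seam `K` and a neighbourhood `N` of it with `closure N ⊆ U`
  haveI : CompactSpace bC.carrier := bC.compactSpace_carrier
  have hKc : IsCompact (range fun z ↦ jC (bC.incl z)) :=
    isCompact_range (hjC.contMDiff.continuous.comp bC.continuous_incl)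
  have hKU : (range fun z ↦ jC (bC.incl z)) ⊆ U := by
    rintro _ ⟨z, rfl⟩
    exact hYU z
  obtain ⟨N, hNo, hKN, hNU⟩ := normal_exists_closure_subset hKc.isClosed hU hKU
  have hNU' : N ⊆ U := subset_closure.trans hNU
  have hKN' : ∀ z, jC (bC.incl z) ∈ N := fun z ↦ hKN ⟨z, rfl⟩
  -- (a) `Φ` is a local diffeomorphism on `U`
  have hbij : ∀ x ∈ U, Bijective (mfderiv (𝓡 4) (𝓡 4) Φ x) := fun x hx ↦
    bijective_mfderiv_of_pullbackBilin_eq g hg (hΦg x hx)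
  have hΦNo : IsOpen (Φ '' N) :=
    isOpen_image_of_bijective_mfderiv hNo (hΦs.mono hNU') fun x hx ↦ hbij x (hNU' hx)
  have hseamΦ : ∀ z, jC (bC.incl z) ∈ Φ '' N := fun z ↦
    ⟨jC (bC.incl (τ.symm z)), hKN' _, by rw [hΦτ, Diffeomorph.apply_symm_apply]⟩
  -- (c) the open pieces `M₁ ⊇ jC C`, `M₂ ⊇ jW W`
  let M₁ : TopologicalSpace.Opens S := ⟨RWᶜ ∪ N, hRWc.isOpen_compl.union hNo⟩
  let M₂ : TopologicalSpace.Opens S := ⟨RCᶜ ∪ Φ '' N, hRCc.isOpen_compl.union hΦNo⟩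
  have hM₁ : ∀ a, jC a ∈ M₁ := by
    intro a
    by_cases h : jC a ∈ RW
    · obtain ⟨b, hb⟩ := h
      obtain ⟨z, rfl, -⟩ := (hseam a b).1 hb.symm
      exact Or.inr (hKN' z)
    · exact Or.inl h
  have hM₂ : ∀ b, jW b ∈ M₂ := by
    intro b
    by_cases h : jW b ∈ RC
    · obtain ⟨a, ha⟩ := h
      obtain ⟨z, rfl, rfl⟩ := (hseam a b).1 ha
      show jW (bW.incl (φ z)) ∈ RCᶜ ∪ Φ '' N
      rw [← ha]
      exact Or.inr (hseamΦ z)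
    · exact Or.inl h
  haveI : Nonempty M₁ := ⟨⟨jC (bC.incl (Classical.arbitrary _)), hM₁ _⟩⟩
  haveI : Nonempty M₂ := ⟨⟨jC (bC.incl (Classical.arbitrary _)), Or.inr (hseamΦ _)⟩⟩
  have hNM₁ : N ⊆ (M₁ : Set S) := fun x hx ↦ Or.inr hx
  have hNM₂ : Φ '' N ⊆ (M₂ : Set S) := fun x hx ↦ Or.inr hx
  -- (d) the glue datum `Φ| : N → Φ(N)` between the open submanifolds `M₁`, `M₂`
  obtain ⟨d, hsrc, hval⟩ := exists_smoothGlueData hU hNo hNU' hΦs hΦi hbij M₁ M₂ hNM₁ hNM₂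
  -- (f) the piece embeddings into the glued manifold `X = M₁ ∪_Φ M₂`
  set jC₁ : C → M₁ := fun a ↦ ⟨jC a, hM₁ a⟩ with hjC₁
  set jW₂ : W → M₂ := fun b ↦ ⟨jW b, hM₂ b⟩ with hjW₂
  have hjC₁e : Manifold.IsSmoothEmbedding (𝓡∂ 4) (𝓡 4) ∞ jC₁ := hjC.opensCodRestrict M₁ hM₁
  have hjW₂e : Manifold.IsSmoothEmbedding (𝓡∂ 4) (𝓡 4) ∞ jW₂ := hjW.opensCodRestrict M₂ hM₂
  have hkC : Manifold.IsSmoothEmbedding (𝓡∂ 4) (𝓡 4) ∞ (d.inl ∘ jC₁) :=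
    d.isSmoothEmbedding_inl_comp hjC₁e
  have hkW : Manifold.IsSmoothEmbedding (𝓡∂ 4) (𝓡 4) ∞ (d.inr ∘ jW₂) :=
    d.isSmoothEmbedding_inr_comp hjW₂e
  -- the gluing identification read on the pieces
  have hglue_iff : ∀ a b, d.inl (jC₁ a) = d.inr (jW₂ b) ↔ jC a ∈ N ∧ Φ (jC a) = jW b := by
    intro a b
    rw [d.inl_eq_inr_iff, hsrc (jC₁ a)]
    constructor
    · rintro ⟨ha, hab⟩
      exact ⟨ha, (hval (jC₁ a) ha).symm.trans (congrArg Subtype.val hab)⟩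
    · rintro ⟨ha, hab⟩
      exact ⟨ha, Subtype.ext ((hval (jC₁ a) ha).trans hab)⟩
  -- the seam relation of the twisted gluing
  have hseam' : ∀ a b, (d.inl ∘ jC₁) a = (d.inr ∘ jW₂) b ↔
      ∃ z, a = bC.incl z ∧ b = bW.incl ((τ.trans φ) z) := by
    intro a b
    rw [comp_apply, comp_apply, hglue_iff]
    constructor
    · rintro ⟨haN, hab⟩
      have haU : jC a ∈ U := hNU' haN
      obtain ⟨a', ha'⟩ := hΦC _ haU ⟨a, rfl⟩
      obtain ⟨z', rfl, rfl⟩ := (hseam a' b).1 (ha'.trans hab)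
      refine ⟨τ.symm z', hjC.isEmbedding.injective (hΦi haU (hYU _) ?_), ?_⟩
      · rw [hΦτ (τ.symm z'), Diffeomorph.apply_symm_apply]
        exact ha'.symm
      · simp only [Diffeomorph.coe_trans, comp_apply, Diffeomorph.apply_symm_apply]
    · rintro ⟨z, rfl, rfl⟩
      refine ⟨hKN' z, ?_⟩
      rw [hΦτ z, Diffeomorph.coe_trans, comp_apply]
      exact (hseam _ _).2 ⟨τ z, rfl, rfl⟩
  -- the two pieces cover `X`
  have hcov' : range (d.inl ∘ jC₁) ∪ range (d.inr ∘ jW₂) = univ := by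
    refine eq_univ_of_forall fun p ↦ ?_
    obtain (⟨x, rfl⟩ | ⟨y, rfl⟩) := d.exists_inl_or_inr p
    · by_cases hx : (x : S) ∈ RC
      · obtain ⟨a, ha⟩ := hx
        refine Or.inl ⟨a, ?_⟩
        rw [comp_apply]
        congr 1
        exact Subtype.ext ha
      · have hxW : (x : S) ∈ RW := (hcovx x).resolve_left hx
        have hxN : (x : S) ∈ N := x.2.resolve_left fun h ↦ h hxW
        obtain ⟨b, hb⟩ := hΦW _ (hNU' hxN) hxW
        refine Or.inr ⟨b, ?_⟩
        rw [comp_apply, eq_comm, d.inl_eq_inr_iff]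
        refine ⟨(hsrc x).2 hxN, Subtype.ext ?_⟩
        rw [hval x hxN]
        exact hb.symm
    · by_cases hy : (y : S) ∈ RW
      · obtain ⟨b, hb⟩ := hy
        refine Or.inr ⟨b, ?_⟩
        rw [comp_apply]
        congr 1
        exact Subtype.ext hb
      · have hyC : (y : S) ∈ RC := (hcovx y).resolve_right hy
        have hyN : (y : S) ∈ Φ '' N := y.2.resolve_left fun h ↦ h hyC
        obtain ⟨x, hxN, hxy⟩ := hyN
        have hxC : x ∈ RC := by
          by_contra hxC
          exact hy (hxy ▸ hΦW x (hNU' hxN) ((hcovx x).resolve_left hxC))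
        obtain ⟨a, rfl⟩ := hxC
        refine Or.inl ⟨a, ?_⟩
        rw [comp_apply, d.inl_eq_inr_iff]
        refine ⟨(hsrc _).2 hxN, Subtype.ext ?_⟩
        rw [hval _ hxN]
        exact hxy
  -- (g) the metrics `g|M₁`, `g|M₂` and the glued metric
  have hι₁ : ContMDiff (𝓡 4) (𝓡 4) (((⊤ : ℕ∞) : ℕ∞ω) + 1) (Subtype.val : M₁ → S) :=
    contMDiff_subtype_val
  have hι₁' : ∀ u : M₁, Injective (mfderiv (𝓡 4) (𝓡 4) (Subtype.val : M₁ → S) u) := fun u ↦ by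
    rw [OpenSubmanifold.mfderiv_subtype_val]
    exact fun v w h ↦ h
  have hι₂ : ContMDiff (𝓡 4) (𝓡 4) (((⊤ : ℕ∞) : ℕ∞ω) + 1) (Subtype.val : M₂ → S) :=
    contMDiff_subtype_val
  have hι₂' : ∀ u : M₂, Injective (mfderiv (𝓡 4) (𝓡 4) (Subtype.val : M₂ → S) u) := fun u ↦ by
    rw [OpenSubmanifold.mfderiv_subtype_val]
    exact fun v w h ↦ h
  set gA := g.comap (contMDiff_pullbackBilin_holds (I := 𝓡 4) (M := S) (I' := 𝓡 4) (N := M₁))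
    Subtype.val hι₁ hι₁' rfl with hgA
  set gB := g.comap (contMDiff_pullbackBilin_holds (I := 𝓡 4) (M := S) (I' := 𝓡 4) (N := M₂))
    Subtype.val hι₂ hι₂' rfl with hgB
  have hgAv : gA.val = pullbackBilin (I := 𝓡 4) (I' := 𝓡 4) (Subtype.val : M₁ → S) g.val := rfl
  have hgBv : gB.val = pullbackBilin (I := 𝓡 4) (I' := 𝓡 4) (Subtype.val : M₂ → S) g.val := rfl
  have hgAR : gA.IsRiemannian := fun u v hv ↦ by
    rw [hgAv, pullbackBilin_apply, OpenSubmanifold.mfderiv_subtype_val]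
    exact hg u.1 v hv
  have hgBR : gB.IsRiemannian := fun u v hv ↦ by
    rw [hgBv, pullbackBilin_apply, OpenSubmanifold.mfderiv_subtype_val]
    exact hg u.1 v hv
  -- `Φ|` is an isometry `g|M₁ → g|M₂` on `N`
  have hiso : ∀ a ∈ d.glue.source, ∀ v w : TangentSpace (𝓡 4) a,
      gB.val (d.glue a) (mfderiv (𝓡 4) (𝓡 4) d.glue a v) (mfderiv (𝓡 4) (𝓡 4) d.glue a w) =
        gA.val a v w := by
    intro a ha v w
    have haN : (a : S) ∈ N := (hsrc a).1 ha
    rw [hgAv, hgBv, pullbackBilin_apply, pullbackBilin_apply]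
    have e1 : ∀ u : TangentSpace (𝓡 4) a,
        mfderiv (𝓡 4) (𝓡 4) (Subtype.val : M₂ → S) (d.glue a) (mfderiv (𝓡 4) (𝓡 4) d.glue a u) =
          mfderiv (𝓡 4) (𝓡 4) Φ (a : S) u := fun u ↦ by
      rw [OpenSubmanifold.mfderiv_subtype_val]
      exact mfderiv_glue_apply d hsrc hval hU hNU' hΦs haN u
    have e2 : ∀ u : TangentSpace (𝓡 4) a,
        mfderiv (𝓡 4) (𝓡 4) (Subtype.val : M₁ → S) a u = u := fun u ↦ by
      rw [OpenSubmanifold.mfderiv_subtype_val]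
      rfl
    have hgen : ∀ x : S, x = Φ a → ∀ (v₀ w₀ : TangentSpace (𝓡 4) x)
        (v₁ w₁ : TangentSpace (𝓡 4) (Φ (a : S))), v₀ = v₁ → w₀ = w₁ →
        g.val x v₀ w₀ = g.val (Φ a) v₁ w₁ := by
      rintro x rfl v₀ w₀ v₁ w₁ rfl rfl
      rfl
    refine (hgen _ (hval a haN) _ _ _ _ (e1 v) (e1 w)).trans ?_
    rw [e2 v, e2 w]
    exact DFunLike.congr_fun (DFunLike.congr_fun (hΦg _ (hNU' haN)) v) w
  obtain ⟨γ, hγA, hγB⟩ := d.exists_metric_of_glue_isometry gA gB hiso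
  have hγR : γ.IsRiemannian := d.isRiemannian_of_glue gA gB γ hγA hγB hgAR hgBR
  -- naturality: `kC^* γ = jC₁^* inl^* γ = jC₁^* g|M₁ = (ι ∘ jC₁)^* g = jC^* g`
  have hinl : MDifferentiable (𝓡 4) (𝓡 4) d.inl := d.contMDiff_inl.mdifferentiable (by simp)
  have hinr : MDifferentiable (𝓡 4) (𝓡 4) d.inr := d.contMDiff_inr.mdifferentiable (by simp)
  have hjC₁md : MDifferentiable (𝓡∂ 4) (𝓡 4) jC₁ := hjC₁e.contMDiff.mdifferentiable (by simp)
  have hjW₂md : MDifferentiable (𝓡∂ 4) (𝓡 4) jW₂ := hjW₂e.contMDiff.mdifferentiable (by simp)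
  have hval₁ : MDifferentiable (𝓡 4) (𝓡 4) (Subtype.val : M₁ → S) := fun u ↦
    OpenSubmanifold.mdifferentiableAt_subtype_val u
  have hval₂ : MDifferentiable (𝓡 4) (𝓡 4) (Subtype.val : M₂ → S) := fun u ↦
    OpenSubmanifold.mdifferentiableAt_subtype_val u
  have hγA' : pullbackBilin (I := 𝓡 4) (I' := 𝓡 4) d.inl γ.val = gA.val := by
    funext a
    ext v w
    exact hγA a v w
  have hγB' : pullbackBilin (I := 𝓡 4) (I' := 𝓡 4) d.inr γ.val = gB.val := by
    funext b
    ext v w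
    exact hγB b v w
  have hpbC : ∀ c, pullbackBilin (I := 𝓡 4) (I' := 𝓡∂ 4) jC g.val c =
      pullbackBilin (I := 𝓡 4) (I' := 𝓡∂ 4) (d.inl ∘ jC₁) γ.val c := by
    intro c
    rw [pullbackBilin_comp hinl hjC₁md, hγA', hgAv, ← pullbackBilin_comp hval₁ hjC₁md]
    rfl
  have hpbW : ∀ w, pullbackBilin (I := 𝓡 4) (I' := 𝓡∂ 4) jW g.val w =
      pullbackBilin (I := 𝓡 4) (I' := 𝓡∂ 4) (d.inr ∘ jW₂) γ.val w := by
    intro w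
    rw [pullbackBilin_comp hinr hjW₂md, hγB', hgBv, ← pullbackBilin_comp hval₂ hjW₂md]
    rfl
  exact ⟨d.Glued, inferInstance, inferInstance, inferInstance, d.inl ∘ jC₁, d.inr ∘ jW₂, γ, hkC,
    hkW, hcov', hseam', hγR, hpbC, hpbW⟩

/-- **Stub B2 — isometric regluing realises the cork twist** (`stub_isometricRegluing` of the
line `registered` of the crux `CorkRegluingBudget`, signature verbatim).  Let `S⁴ = C ∪_φ W` be
presented by piece embeddings `jC, jW`, `g` a Riemannian metric on `S⁴`, and `Φ` a map which on
an open neighbourhood `U` of the seam is smooth, injective, a `g`-isometry, side-preserving, and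
restricts to `τ` on the seam.  Then every smooth 4-manifold `P` which is a boundary gluing
`C ∪_{φ ∘ τ} W` carries smooth embeddings `kC : C → P`, `kW : W → P` covering `P` and meeting
exactly along `kC (ι z) = kW (ι (φ (τ z)))`, and a Riemannian metric `γ` with `jC^* g = kC^* γ`,
`jW^* g = kW^* γ`.  Proof: `isometricOpenRegluing` (the open regluing `X = M₁ ∪_Φ M₂` with its
patched metric; if the seam is empty, `S⁴` itself is already the twisted gluing) followed by
`isometricTransport` (uniqueness of boundary gluings `X ≅ P`, Hirsch Ch. 8 §2 Thm. 2.1, and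
naturality of the pullback). [cite: HirschDT1976, Ch. 8 §2, Thm. 2.1]
[cite: BrockerJanich1982, §13] [cite: ONeill1983, Ch. 3, pp. 58, 90–91] -/
theorem stub_isometricRegluing :
    ∀ (C : Type) [TopologicalSpace C] [T2Space C] [SecondCountableTopology C]
      [ChartedSpace (EuclideanHalfSpace 4) C] [IsManifold (𝓡∂ 4) ∞ C] [CompactSpace C]
      (bC : Literature.Topology.FourManifolds.BoundaryData (𝓡∂ 4) C (𝓡 3))
      (W : Type) [TopologicalSpace W] [T2Space W] [SecondCountableTopology W]
      [ChartedSpace (EuclideanHalfSpace 4) W] [IsManifold (𝓡∂ 4) ∞ W] [CompactSpace W]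
      (bW : Literature.Topology.FourManifolds.BoundaryData (𝓡∂ 4) W (𝓡 3))
      (φ : bC.carrier ≃ₘ⟮𝓡 3, 𝓡 3⟯ bW.carrier) (τ : bC.carrier ≃ₘ⟮𝓡 3, 𝓡 3⟯ bC.carrier)
      (jC : C → Metric.sphere (0 : EuclideanSpace ℝ (Fin 5)) 1)
      (jW : W → Metric.sphere (0 : EuclideanSpace ℝ (Fin 5)) 1)
      (g : Literature.Geometry.Lorentzian.PseudoRiemannianMetric (𝓡 4) ∞ (EuclideanSpace ℝ (Fin 4))
          (TangentSpace (𝓡 4) : Metric.sphere (0 : EuclideanSpace ℝ (Fin 5)) 1 → Type _))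
      (U : Set (Metric.sphere (0 : EuclideanSpace ℝ (Fin 5)) 1))
      (Φ : Metric.sphere (0 : EuclideanSpace ℝ (Fin 5)) 1 → Metric.sphere (0 : EuclideanSpace ℝ (Fin 5)) 1),
      Manifold.IsSmoothEmbedding (𝓡∂ 4) (𝓡 4) ∞ jC →
      Manifold.IsSmoothEmbedding (𝓡∂ 4) (𝓡 4) ∞ jW →
      Set.range jC ∪ Set.range jW = Set.univ →
      (∀ a b, jC a = jW b ↔ ∃ z, a = bC.incl z ∧ b = bW.incl (φ z)) →
      g.IsRiemannian →
      IsOpen U →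
      (∀ z, jC (bC.incl z) ∈ U) →
      ContMDiffOn (𝓡 4) (𝓡 4) ∞ Φ U →
      Set.InjOn Φ U →
      (∀ x ∈ U, Literature.Geometry.Lorentzian.pullbackBilin (I := 𝓡 4) (I' := 𝓡 4) Φ g.val x = g.val x) →
      (∀ x ∈ U, x ∈ Set.range jC → Φ x ∈ Set.range jC) →
      (∀ x ∈ U, x ∈ Set.range jW → Φ x ∈ Set.range jW) →
      (∀ z, Φ (jC (bC.incl z)) = jC (bC.incl (τ z))) →
      ∀ (P : Type) [TopologicalSpace P] [T2Space P] [SecondCountableTopology P]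
        [ChartedSpace (EuclideanSpace ℝ (Fin 4)) P] [IsManifold (𝓡 4) ∞ P],
        Literature.Topology.FourManifolds.IsBoundaryGluing bC bW (τ.trans φ) (𝓡 4) P →
        ∃ (kC : C → P) (kW : W → P)
          (γ : Literature.Geometry.Lorentzian.PseudoRiemannianMetric (𝓡 4) ∞ (EuclideanSpace ℝ (Fin 4))
          (TangentSpace (𝓡 4) : P → Type _)),
          Manifold.IsSmoothEmbedding (𝓡∂ 4) (𝓡 4) ∞ kC ∧
            Manifold.IsSmoothEmbedding (𝓡∂ 4) (𝓡 4) ∞ kW ∧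
            Set.range kC ∪ Set.range kW = Set.univ ∧
            (∀ a b, kC a = kW b ↔ ∃ z, a = bC.incl z ∧ b = bW.incl ((τ.trans φ) z)) ∧
            γ.IsRiemannian ∧
            (∀ c, Literature.Geometry.Lorentzian.pullbackBilin (I := 𝓡 4) (I' := 𝓡∂ 4) jC g.val c =
              Literature.Geometry.Lorentzian.pullbackBilin (I := 𝓡 4) (I' := 𝓡∂ 4) kC γ.val c) ∧
            (∀ w, Literature.Geometry.Lorentzian.pullbackBilin (I := 𝓡 4) (I' := 𝓡∂ 4) jW g.val w =
              Literature.Geometry.Lorentzian.pullbackBilin (I := 𝓡 4) (I' := 𝓡∂ 4) kW γ.val w) := by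
  intro C _ _ _ _ _ _ bC W _ _ _ _ _ _ bW φ τ jC jW g U Φ hjC hjW hcov hseam hg hU hYU hΦs hΦi hΦg
    hΦC hΦW hΦτ P _ _ _ _ _ hP
  rcases isEmpty_or_nonempty bC.carrier with hE | hNE
  · -- empty seam: `S⁴` itself, with `jC`, `jW`, `g`, is already the twisted gluing
    have hseam₀ : ∀ a b, jC a = jW b ↔ ∃ z, a = bC.incl z ∧ b = bW.incl ((τ.trans φ) z) := by
      intro a b
      rw [hseam a b]
      constructor
      · rintro ⟨z, -, -⟩
        exact isEmptyElim z
      · rintro ⟨z, -, -⟩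
        exact isEmptyElim z
    obtain ⟨kC, kW, γ, h1, h2, h3, h4, h5, h6, h7⟩ :=
      isometricTransport C bC W bW (τ.trans φ) (Metric.sphere (0 : EuclideanSpace ℝ (Fin 5)) 1) P
        jC jW g hjC hjW hcov hseam₀ hg hP
    exact ⟨kC, kW, γ, h1, h2, h3, h4, h5, fun c ↦ (h6 c).symm, fun w ↦ (h7 w).symm⟩
  · -- nonempty seam: the open regluing `X = M₁ ∪_Φ M₂`, transported to `P`
    obtain ⟨X, _, _, _, kC', kW', γ', h1, h2, h3, h4, h5, h6, h7⟩ :=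
      isometricOpenRegluing C bC W bW φ τ (Metric.sphere (0 : EuclideanSpace ℝ (Fin 5)) 1) jC jW g
        U Φ hjC hjW hcov hseam hg hU hYU hΦs hΦi hΦg hΦC hΦW hΦτ
    obtain ⟨kC, kW, γ, e1, e2, e3, e4, e5, e6, e7⟩ :=
      isometricTransport C bC W bW (τ.trans φ) X P kC' kW' γ' h1 h2 h3 h4 h5 hP
    exact ⟨kC, kW, γ, e1, e2, e3, e4, e5, fun c ↦ (h6 c).trans (e6 c).symm,
      fun w ↦ (h7 w).trans (e7 w).symm⟩

end Summit.SmoothPoincare4.SmoothPoincare4.Theorems.CorkRegluingBudget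

end
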